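import Summits.BirchSwinnertonDyer.BirchSwinnertonDyer.Theorems.SignedBaseChangeAnticyclotomicEisensteinDivisibilitySpecializationS2Torsion
import HarnessLib

/-!
# Stub S2 of line `bdpline` with the `T₁`-torsion-freeness input replaced by Greenberg's printed shape
# "`X_Gr₂` has no non-zero pseudo-null `Λ₂`-submodule"

Helper file (--supports stmt-BirchSwinnertonDyer-20727), sequel of `…SpecializationS2Torsion.lean`
(lead prover sbc-p1 g7). The remaining hypothesis `X_Gr₂[T₁] = 0` of
`S2.xGr₂_specialization_le_of_isTorsion` is only used when `(T₁) ∉ Supp X_Gr₂`; in that case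
`X_Gr₂[T₁]` IS a pseudo-null `Λ₂`-submodule (`isPseudoNull_torsionBy_of_lengthAt_eq_zero`: it dies at
`(T₁)` because `X_Gr₂` does, and at every other prime of height `≤ 1` because `T₁` kills it), so it
vanishes as soon as `X_Gr₂` has no non-zero pseudo-null submodule — the VERBATIM shape of Greenberg,
*On the structure of Selmer groups* (2016), Prop. 4.1.1, and of the tree's
`IwasawaTheory.iwasawaAlgebraTwoVar_eq_bot_of_isPseudoNull_of_exact` (modules with a square free
presentation). Result: `S2.xGr₂_specialization_le_of_noPseudoNull` — the conclusion of stub S2 from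
`[Module.Finite Λ₂ X_Gr₂]`, `Module.IsTorsion Λ₂ X_Gr₂`, "no non-zero pseudo-null submodule", and the
control surjection (PROVED, `SignedBaseChangeAcDivControl.stub_controlSurjSS`). Pure algebra; nothing
about elliptic curves is asserted.
-/

-- D-0017: single-problem summit, the namespace repeats the problem name by design.
set_option linter.dupNamespace false
set_option autoImplicit false

noncomputable section

open Function
open scoped Pointwise

namespace Summit.BirchSwinnertonDyer.BirchSwinnertonDyer.Theorems.SignedBaseChangeAcDivSpecialization

open Literature.NumberTheory.EllipticCurves Literature.NumberTheory.EllipticCurves.Module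

namespace LocalLength

variable {R : Type*} [CommRing R] {M : Type*} [AddCommGroup M] [Module R M]

/-- **`M[x]` is pseudo-null when `M` is torsion and dies at the height-one prime `(x)`** (`x` a prime
element of a Noetherian domain): at a prime `𝔭 ∌ x` of height `≤ 1` the module `M[x]` is killed by the
unit `x`; at `𝔭 ∋ x` of height `≤ 1`, `𝔭 = (x)` (or `𝔭 = 0`, excluded by `x ≠ 0`) and
`M[x]_𝔭 ⊆ M_𝔭 = 0`. [folklore] -/
theorem isPseudoNull_torsionBy_of_lengthAt_eq_zero [IsNoetherianRing R] [IsDomain R] {x : R}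
    (hx : Prime x) (h0 : lengthAt R M ⟨Ideal.span {x}, (Ideal.span_singleton_prime hx.ne_zero).mpr hx⟩ = 0) :
    IsPseudoNull R (Submodule.torsionBy R M x) := by
  intro 𝔭 h𝔭
  by_cases hmem : x ∈ 𝔭.asIdeal
  · -- `𝔭 = (x)`: `M[x]_𝔭 ↪ M_𝔭 = 0`
    have hne : 𝔭.asIdeal ≠ ⊥ := fun h => hx.ne_zero (by rw [h, Ideal.mem_bot] at hmem; exact hmem)
    have hht : 𝔭.asIdeal.height = 1 := by
      refine le_antisymm h𝔭 ?_
      rw [Order.one_le_iff_ne_zero, Ne, Ideal.height_eq_zero_iff_eq_bot]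
      exact hne
    have heq : 𝔭 = ⟨Ideal.span {x}, (Ideal.span_singleton_prime hx.ne_zero).mpr hx⟩ :=
      PrimeSpectrum.ext (Ideal.eq_span_singleton_of_height_eq_one hht hmem hx)
    subst heq
    have hle := lengthAt_le_of_injective (Submodule.torsionBy R M x).subtype
      (Submodule.subtype_injective _) ⟨Ideal.span {x}, (Ideal.span_singleton_prime hx.ne_zero).mpr hx⟩
    rw [h0, nonpos_iff_eq_zero] at hle
    exact (lengthAt_eq_zero_iff _).mp hle
  · -- `x ∉ 𝔭` kills `M[x]`
    rw [LocalizedModule.subsingleton_iff]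
    intro m
    exact ⟨x, hmem, Subtype.ext (by
      rw [Submodule.coe_smul, Submodule.coe_zero]
      exact (Submodule.mem_torsionBy_iff x (m : M)).mp m.2)⟩

/-- If `M` has no non-zero pseudo-null submodule and dies at `(x)`, then `x` is injective on `M`.
[folklore] -/
theorem torsionBy_eq_bot_of_noPseudoNull [IsNoetherianRing R] [IsDomain R] {x : R} (hx : Prime x)
    (h0 : lengthAt R M ⟨Ideal.span {x}, (Ideal.span_singleton_prime hx.ne_zero).mpr hx⟩ = 0)
    (hPN : ∀ N : Submodule R M, IsPseudoNull R N → N = ⊥) :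
    ∀ m : M, x • m = 0 → m = 0 := fun m hm => by
  have h := hPN _ (isPseudoNull_torsionBy_of_lengthAt_eq_zero hx h0)
  have : m ∈ Submodule.torsionBy R M x := (Submodule.mem_torsionBy_iff x m).mpr hm
  rw [h] at this
  exact (Submodule.mem_bot R).mp this

end LocalLength

namespace S2

open LocalLength PowerSeriesSpecialization

/-- **Stub S2 from "f.g. + torsion + no non-zero pseudo-null submodule + control".** For a finitely
generated torsion `Λ₂`-module `X` with no non-zero pseudo-null submodule (Greenberg 2016 Prop. 4.1.1
shape) and a surjective `Λ₁`-linear control map `X/T₁X ↠ Y` (constants structure):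
`π(ch_{Λ₂} X · Λ^ur) ⊆ ch_{Λ₁}(Y) · 𝒪⟦T⟧`. Dichotomy on `(T₁) ∈ Supp X`: if not, `X[T₁]` is pseudo-null,
hence zero, and `map_toUnr₂_map_constantCoeff_le` applies; if so, the left side is `0`. [folklore] -/
theorem map_toUnr₂_map_constantCoeff_le_of_noPseudoNull (p : ℕ) [Fact p.Prime] (X : Type*)
    [AddCommGroup X] [Module (PowerSeries (IwasawaAlgebra p)) X]
    [Module.Finite (PowerSeries (IwasawaAlgebra p)) X]
    (Y : Type*) [AddCommGroup Y] [Module (IwasawaAlgebra p) Y]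
    (htors : Module.IsTorsion (PowerSeries (IwasawaAlgebra p)) X)
    (hPN : ∀ N : Submodule (PowerSeries (IwasawaAlgebra p)) X,
      IsPseudoNull (PowerSeries (IwasawaAlgebra p)) N → N = ⊥)
    (f : letI : Module (IwasawaAlgebra p)
              (QuotSMulTop (PowerSeries.X : PowerSeries (IwasawaAlgebra p)) X) :=
            Module.compHom _ (PowerSeries.C (R := IwasawaAlgebra p))
      QuotSMulTop (PowerSeries.X : PowerSeries (IwasawaAlgebra p)) X →ₗ[IwasawaAlgebra p] Y)
    (hf : Surjective f) (J : ℤ_[p] →+* PadicComplexInt p) :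
    ((charIdeal (PowerSeries (IwasawaAlgebra p)) X).map (IwasawaAlgebra₂.toUnr₂ p J)).map
        (PowerSeries.constantCoeff (R := PowerSeries (PadicComplexInt p))) ≤
      (charIdeal (IwasawaAlgebra p) Y).map (PowerSeries.map J) := by
  have hXp : Prime (PowerSeries.X : PowerSeries (IwasawaAlgebra p)) := PowerSeries.X_prime
  by_cases h0 : lengthAt (PowerSeries (IwasawaAlgebra p)) X
      ⟨Ideal.span {(PowerSeries.X : PowerSeries (IwasawaAlgebra p))},
        (Ideal.span_singleton_prime hXp.ne_zero).mpr hXp⟩ = 0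
  · obtain ⟨s, hsX, hs⟩ := exists_notMem_forall_smul_eq_zero_of_lengthAt_eq_zero h0
    exact map_toUnr₂_map_constantCoeff_le p X Y
      ⟨s, fun h => hsX ((mem_span_X_iff (A := IwasawaAlgebra p)).mpr h), hs⟩
      (torsionBy_eq_bot_of_noPseudoNull hXp h0 hPN) f hf J
  · rw [map_toUnr₂_map_constantCoeff_eq_bot_of_lengthAt_ne_zero p X htors h0 J]
    exact bot_le

/-- **Stub S2 of line `bdpline` for the constructed carriers from "`X_Gr₂` f.g. torsion with no non-zero
pseudo-null submodule" + control** — the shape consumed by skeleton v4 (stubs `stub_fgTorsionSS`,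
`stub_noPseudoNullSS`, and the PROVED `stub_controlSurjSS`). [folklore] -/
theorem xGr₂_specialization_le_of_noPseudoNull {K : Type} [Field K] [NumberField K]
    (W : WeierstrassCurve K) (p : ℕ) [Fact p.Prime] (κ₁ κ₂ : ZpExtension K p)
    (vbar : IsDedekindDomain.HeightOneSpectrum (NumberField.RingOfIntegers K))
    (γ₁ γ₂ : Field.absoluteGaloisGroup K) [Fact (ZpExtension.IsTopGeneratorPair κ₁ κ₂ γ₁ γ₂)]
    [Fact (κ₂.IsTopGenerator γ₂)]
    [Module.Finite (IwasawaAlgebra₂ p) (W.XGr₂ p κ₁ κ₂ vbar γ₁ γ₂)]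
    (htors : Module.IsTorsion (IwasawaAlgebra₂ p) (W.XGr₂ p κ₁ κ₂ vbar γ₁ γ₂))
    (hPN : ∀ N : Submodule (IwasawaAlgebra₂ p) (W.XGr₂ p κ₁ κ₂ vbar γ₁ γ₂),
      IsPseudoNull (IwasawaAlgebra₂ p) N → N = ⊥)
    (f : letI : Module (IwasawaAlgebra p)
              (QuotSMulTop (PowerSeries.X : IwasawaAlgebra₂ p) (W.XGr₂ p κ₁ κ₂ vbar γ₁ γ₂)) :=
            Module.compHom _ (PowerSeries.C (R := IwasawaAlgebra p))
      QuotSMulTop (PowerSeries.X : IwasawaAlgebra₂ p) (W.XGr₂ p κ₁ κ₂ vbar γ₁ γ₂) →ₗ[IwasawaAlgebra p]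
        Castella2018.AcSelmer.XAc W p κ₂ vbar ∅ γ₂)
    (hf : Surjective f) (J : ℤ_[p] →+* PadicComplexInt p) :
    ((WeierstrassCurve.XGr₂.charIdeal W p κ₁ κ₂ vbar γ₁ γ₂).map (IwasawaAlgebra₂.toUnr₂ p J)).map
        (PowerSeries.constantCoeff (R := PowerSeries (PadicComplexInt p))) ≤
      (Castella2018.AcSelmer.XAc.charIdeal W p κ₂ vbar ∅ γ₂).map (PowerSeries.map J) :=
  map_toUnr₂_map_constantCoeff_le_of_noPseudoNull p (W.XGr₂ p κ₁ κ₂ vbar γ₁ γ₂)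
    (Castella2018.AcSelmer.XAc W p κ₂ vbar ∅ γ₂) htors hPN f hf J

end S2

end Summit.BirchSwinnertonDyer.BirchSwinnertonDyer.Theorems.SignedBaseChangeAcDivSpecialization

end
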